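import Summits.BirchSwinnertonDyer.Rank1Residual.Additive.X4SharpThreeKimShape
import Summits.BirchSwinnertonDyer.Rank1Residual.Additive.X4SharpThreeResidue
import Summits.BirchSwinnertonDyer.Rank1Residual.Supersingular.SignedRankZero
import HarnessLib

/-!
# N11 — consequences of "Kim 2026 Thm. 1.8 (6) at `p = 3`" in Kim's binder shape: the comparison
# with `X4SharpThree`, consistency with the closed rows, the falsifiable Tamagawa prediction, and the
# LOWER-row lever (cell `b2b-bsdres`, team n1011, seat p03, OWNERS row T-a2; THEOREMS ONLY)

HONEST FRAMING (cell `b2b-bsdres`, run/shared/lean/b2b/bsd-rank1-residual/, verbatim in every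
file): the goal of the cell is to DELETE the COMBINATION-SHAPED residual classes of the
Birch–Swinnerton-Dyer formula for ALL analytic-rank `≤ 1` elliptic curves over `ℚ` — "full BSD
formula for every rank `≤ 1` curve in class `C`" assembled STRICTLY from published theorems — so
that the rank-`≤ 1` remainder becomes exactly the CONSTRUCTION-SHAPED classes, which are TYPED
(missing-input `Prop`s), NOT attempted. This is not "finishing BSD". Team n1011 (N10 / N11): prove
what is provable now; shrink each hard class to its core with data; no claim beyond stated classes.
Research routes; census output = EVIDENCE / conjecture items, never a Literature fact. The label X4
is UNCHANGED by this file; nothing is booked. Theorems only (pure bookkeeping over the tree; no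
definition, no named fact minted; every published input is an explicit named-fact hypothesis —
`hGZK` Gross–Zagier–Kolyvagin, `hmod` modularity; the conjectures of the sibling file
`Additive/X4SharpThreeKimShape.lean` enter ONLY as explicit hypotheses `hK3 : X4SharpThreeKim`,
`hK3u : X4SharpThreeKimUnit`, or per pair `h : KimRankZeroBoundAt W p`).

## What this file proves

§1 Fact-free rank-`0` bookkeeping between Kim's currency `L(E,1)/Ω(W) = q₀` and the census currency
`#Ш_an = q₀ · #E(ℚ)_tors² / ∏ c_ℓ` (the valuation step is x10b's `Supersingular.padicValRat_shaAn_witness`, reused). §2 The per-pair inequality shape `KimRankZeroBoundAt W p` gives,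
at ANY prime, the cell's upper bound `ord_p #Ш ≤ ord_p #Ш_an + ord_p ∏ c_ℓ` (surj ⇒ `p ∤ #tors`),
hence `MissingUpperBoundAt W p` when `p ∤ ∏ c_ℓ` and `BSD(E,p)` when moreover `p ∤ #Ш_an`; at
`5 ≤ p` these are the tree's Kim consumers again (`kimRankZeroBoundAt_of_five_le`). §3 **The
binder-by-binder comparison (REFEREE-1 R3)**: `x4SharpThreeKim_iff_x4SharpThree_tower` —
granted GZK + modularity, `X4SharpThreeKim` is EQUIVALENT to `Additive.X4SharpThree` restricted to
the `3`-adic tower rows; `X4SharpThree ⇒ X4SharpThreeKim`, and conversely `X4SharpThreeKim` + the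
EXOTIC rows (surj(3), no tower: Elkies' family) give back `X4SharpThree`. §3b **`x4SharpThreeKim_of_facts`: the INEQUALITY
shape is DISCHARGED MODULO A READING-FACT on N11's tower rows** — it follows from the cell's two
printed upper-half routes (additive-p1's (M) route; the SHARP Kato 2004 Thm. 14.5 (3) + Prop. 14.16 (2)
reading A161 on potentially good rows, no Tamagawa hypothesis — a reading-fact ADMITTED at statement
level with its formal D-closure owed, flag `Kato-14.5(3)-14.16(2)-additive-potgood-reading-sharp`),
i.e. modulo seven named facts; what stays OPEN in Kim's shape is the unit/EQUALITY shape
`X4SharpThreeKimUnit` (the LOWER half) and the EXOTIC rows. (Referee-1 ACK-1 T-a2 proviso (2),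
2026-08-21T05:20Z: wording "discharged modulo the reading-fact", not "not open".) The consistency of both shapes
with every `BSD(E,p)`-closed row, the unit shape's exact boundary, the LOWER lever, the falsifiable
Tamagawa prediction and the `p = 3` census shapes are the sibling file
`Additive/X4SharpThreeKimUnitLever.lean`.

References: C.-H. Kim, Amer. J. Math. 148 (2026) = arXiv:2203.12159v4 Thm. 1.9 (1), (6), Conj. 1.10,
§1.2.5 [Kim2022StructureSelmer]; R. Sakamoto, Doc. Math. 27 (2022) App. §5 [Sakamoto2022pSelmer];
Miller 2011 Def. 1.1 [Miller2011LMS]; Mazur 1977 III §5 [Mazur1977]; Serre 1968 IV §3.4.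
-/

noncomputable section

open scoped Classical MatrixGroups ModularForm

open CongruenceSubgroup WeierstrassCurve Literature.NumberTheory.EllipticCurves
  Literature.NumberTheory.EllipticCurves.ModularForms
  Literature.NumberTheory.EllipticCurves.Rank1Residual
  Literature.NumberTheory.EllipticCurves.Rank1Residual.Typed

namespace Summit.BirchSwinnertonDyer.Rank1Residual.Additive

variable (W : WeierstrassCurve ℚ) [W.IsElliptic] [W.IsGloballyMinimal] (p : ℕ) [Fact p.Prime]

/-! ## §1 Fact-free rank-`0` bookkeeping: `#Ш_an = (L(E,1)/Ω) · #tors² / ∏ c_ℓ` -/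

omit [W.IsGloballyMinimal] in
/-- In analytic rank `0` with `rank E(ℚ) = r_an`: if `L(E,1)/Ω(W) = q₀ ∈ ℚ` then
`#Ш_an = q₀ · #E(ℚ)_tors² / ∏ c_ℓ` (`Reg = 1`). Fact-free. [cite: Miller2011LMS, §1 and Def. 1.1] -/
theorem shaAn_eq_of_rankZero_witness (hmw : W.mordellWeilRank = W.analyticRank)
    (hL : W.entireLFunction 1 ≠ 0) {q₀ : ℚ}
    (hq₀ : W.entireLFunction 1 / (W.realPeriodRat : ℂ) = (q₀ : ℂ)) :
    shaAn W = ((q₀ * (W.torsionOrder : ℚ) ^ 2 / (W.tamagawaProduct : ℚ) : ℚ) : ℂ) := by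
  have hr0 : W.analyticRank = 0 := analyticRank_eq_zero_of_entireLFunction_one_ne_zero hL
  have hmw0 : W.mordellWeilRank = 0 := by rw [hmw, hr0]
  have hΩ : (W.realPeriodRat : ℂ) ≠ 0 := by exact_mod_cast (W.realPeriodRat_pos_holds).ne'
  rw [div_eq_iff hΩ] at hq₀
  have hc0' : (W.tamagawaProduct : ℂ) ≠ 0 := by exact_mod_cast (W.tamagawaProduct_pos').ne'
  rw [shaAn_def, WeierstrassCurve.leadingLCoeff, hr0, iteratedDeriv_zero, Nat.factorial_zero,
    Nat.cast_one, div_one, hq₀, W.regulator_eq_one_of_rank_zero hmw0]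
  push_cast
  field_simp

omit [W.IsGloballyMinimal] in
/-- `L(E,1)/Ω(W) = q₀` with `L(E,1) ≠ 0` forces `q₀ ≠ 0`. Fact-free. [folklore] -/
theorem rankZero_witness_ne_zero (hL : W.entireLFunction 1 ≠ 0) {q₀ : ℚ}
    (hq₀ : W.entireLFunction 1 / (W.realPeriodRat : ℂ) = (q₀ : ℂ)) : q₀ ≠ 0 := by
  have hΩ : (W.realPeriodRat : ℂ) ≠ 0 := by exact_mod_cast (W.realPeriodRat_pos_holds).ne'
  rintro rfl
  rw [Rat.cast_zero, div_eq_zero_iff] at hq₀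
  exact hq₀.elim hL hΩ

/-! ## §2 The inequality shape at a pair ⇒ the census-currency upper bound (any prime) -/

/-- **`KimRankZeroBoundAt W p` ⇒ `ord_p #Ш ≤ ord_p #Ш_an + ord_p ∏ c_ℓ`** on a pair with `ρ̄_{E,p}`
onto, the tower onto, `L(E,1) ≠ 0`, a datum `D` with `p ∤ c_D` (GZK `hGZK` for `rank = r_an` and
the finiteness of `Ш`). The torsion term vanishes (`ρ̄` onto ⇒ `E[p]` irreducible ⇒ `p ∤ #tors`).
At `5 ≤ p` (`kimRankZeroBoundAt_of_five_le`) this is `X4RankZero.padicValNat_shaOrder_le` again.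
[cite: Kim2022StructureSelmer, Thm. 1.9 (6) (PDF p. 8)] [cite: Miller2011LMS, Def. 1.1] -/
theorem padicValNat_shaOrder_le_of_kimRankZeroBoundAt
    (hGZK : rank_eq_analyticRank_of_analyticRank_le_one) (h : KimRankZeroBoundAt W p)
    (hL : W.entireLFunction 1 ≠ 0) (hsurj : W.HasSurjectiveModNGaloisRep p)
    (htower : ∀ n : ℕ, W.HasSurjectiveModNGaloisRep (p ^ n : ℕ))
    {N : ℕ} [NeZero N] (D : ModularParametrizationData W N) (hc : ¬ (p : ℤ) ∣ D.maninConstant) :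
    ∃ q : ℚ, shaAn W = (q : ℂ) ∧
      (padicValNat p W.shaOrder : ℤ) ≤ padicValRat p q + padicValNat p W.tamagawaProduct := by
  have hr0 : W.analyticRank = 0 := analyticRank_eq_zero_of_entireLFunction_one_ne_zero hL
  obtain ⟨hmw, hfin⟩ := hGZK W (by rw [hr0]; exact zero_le_one)
  haveI : Finite W.sha := hfin
  obtain ⟨q₀, hq₀, hle⟩ := h hsurj htower hL hfin D hc
  have hq₀0 : q₀ ≠ 0 := rankZero_witness_ne_zero W hL hq₀
  refine ⟨q₀ * (W.torsionOrder : ℚ) ^ 2 / (W.tamagawaProduct : ℚ),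
    shaAn_eq_of_rankZero_witness W hmw hL hq₀, ?_⟩
  have hsha : padicValNat p (Nat.card (AddCommGroup.primaryComponent W.sha p)) =
      padicValNat p W.shaOrder := by
    unfold WeierstrassCurve.shaOrder
    exact padicValNat_card_addPrimaryComponent p
  rw [Supersingular.padicValRat_shaAn_witness W p
    (hasIrreducibleModPGaloisRep_of_hasSurjectiveModNGaloisRep W p hsurj) hq₀0, ← hsha]
  linarith

/-- **`KimRankZeroBoundAt W p` + `p ∤ ∏ c_ℓ` ⇒ the typed UPPER half `MissingUpperBoundAt W p`**
(`ord_p #Ш ≤ ord_p #Ш_an`). [cite: Kim2022StructureSelmer, Thm. 1.9 (6)] [cite: Miller2011LMS, Def. 1.1] -/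
theorem missingUpperBoundAt_of_kimRankZeroBoundAt
    (hGZK : rank_eq_analyticRank_of_analyticRank_le_one) (h : KimRankZeroBoundAt W p)
    (hL : W.entireLFunction 1 ≠ 0) (hsurj : W.HasSurjectiveModNGaloisRep p)
    (htower : ∀ n : ℕ, W.HasSurjectiveModNGaloisRep (p ^ n : ℕ))
    {N : ℕ} [NeZero N] (D : ModularParametrizationData W N) (hc : ¬ (p : ℤ) ∣ D.maninConstant)
    (htam : ¬ p ∣ W.tamagawaProduct) : MissingUpperBoundAt W p := by
  obtain ⟨q, hq, hle⟩ :=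
    padicValNat_shaOrder_le_of_kimRankZeroBoundAt W p hGZK h hL hsurj htower D hc
  refine ⟨q, hq, ?_⟩
  rw [padicValNat.eq_zero_of_not_dvd htam, Nat.cast_zero, add_zero] at hle
  exact hle

/-- **`KimRankZeroBoundAt W p` + `p ∤ ∏ c_ℓ · #Ш_an` ⇒ `BSD(E,p)`** (Miller): both valuations are
`0` (`bsdp_of_shaOrder_le_of_shaAn_unit`). [cite: Kim2022StructureSelmer, Thm. 1.9 (6)] [cite: Miller2011LMS, §1 and Def. 1.1] -/
theorem bsdp_of_kimRankZeroBoundAt_of_shaAn_unit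
    (hGZK : rank_eq_analyticRank_of_analyticRank_le_one) (h : KimRankZeroBoundAt W p)
    (hL : W.entireLFunction 1 ≠ 0) (hsurj : W.HasSurjectiveModNGaloisRep p)
    (htower : ∀ n : ℕ, W.HasSurjectiveModNGaloisRep (p ^ n : ℕ))
    {N : ℕ} [NeZero N] (D : ModularParametrizationData W N) (hc : ¬ (p : ℤ) ∣ D.maninConstant)
    (htam : ¬ p ∣ W.tamagawaProduct) {q : ℚ} (hq : shaAn W = (q : ℂ)) (hv : padicValRat p q = 0) :
    BSDp W p :=
  bsdp_of_shaOrder_le_of_shaAn_unit W p hGZK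
    (by rw [analyticRank_eq_zero_of_entireLFunction_one_ne_zero hL]; exact zero_le_one)
    (padicValNat_shaOrder_le_of_kimRankZeroBoundAt W p hGZK h hL hsurj htower D hc) htam hq hv

/-! ## §3 `p = 3`: the binder-by-binder comparison with `Additive.X4SharpThree` (REFEREE-1 R3) -/

omit [W.IsGloballyMinimal] in
/-- Converse bookkeeping: the census-currency bound `#Ш_an = q`, `ord_p #Ш ≤ ord_p q + ord_p ∏ c_ℓ`
in analytic rank `0` (with `rank = r_an`, `Ш` finite, `E[p]` irreducible) gives Kim's conclusion
`L(E,1)/Ω(W) = q₀ ∈ ℚ`, `ord_p #Ш(p) ≤ ord_p q₀` with `q₀ = q · ∏ c_ℓ / #tors²`. Fact-free.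
[cite: Miller2011LMS, §1 and Def. 1.1] [cite: Mazur1977, Ch. III §5, p. 157] -/
theorem kimConclusion_of_shaOrder_le (hmw : W.mordellWeilRank = W.analyticRank) [Finite W.sha]
    (hL : W.entireLFunction 1 ≠ 0) (hirr : W.HasIrreducibleModPGaloisRep p)
    (hub : ∃ q : ℚ, shaAn W = (q : ℂ) ∧
      (padicValNat p W.shaOrder : ℤ) ≤ padicValRat p q + padicValNat p W.tamagawaProduct) :
    ∃ q₀ : ℚ, W.entireLFunction 1 / (W.realPeriodRat : ℂ) = (q₀ : ℂ) ∧
      (padicValNat p (Nat.card (AddCommGroup.primaryComponent W.sha p)) : ℤ) ≤ padicValRat p q₀ := by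
  obtain ⟨q, hq, hle⟩ := hub
  have hΩpos : 0 < W.realPeriodRat := W.realPeriodRat_pos_holds
  have hΩ : (W.realPeriodRat : ℂ) ≠ 0 := by exact_mod_cast hΩpos.ne'
  -- the rational `q₀ := L(E,1)/Ω(W)` exists: it is `q · ∏ c_ℓ / #tors²`
  set q₀ : ℚ := q * (W.tamagawaProduct : ℚ) / (W.torsionOrder : ℚ) ^ 2 with hq₀def
  have ht0 : (W.torsionOrder : ℚ) ≠ 0 := by exact_mod_cast (W.torsionOrder_pos_holds).ne'
  have hc0 : (W.tamagawaProduct : ℚ) ≠ 0 := by exact_mod_cast (W.tamagawaProduct_pos').ne'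
  have hr0 : W.analyticRank = 0 := analyticRank_eq_zero_of_entireLFunction_one_ne_zero hL
  have hmw0 : W.mordellWeilRank = 0 := by rw [hmw, hr0]
  have hq₀ : W.entireLFunction 1 / (W.realPeriodRat : ℂ) = (q₀ : ℂ) := by
    have ht0' : (W.torsionOrder : ℂ) ≠ 0 := by exact_mod_cast (W.torsionOrder_pos_holds).ne'
    have hc0' : (W.tamagawaProduct : ℂ) ≠ 0 := by exact_mod_cast (W.tamagawaProduct_pos').ne'
    have hsha := hq
    rw [shaAn_def, WeierstrassCurve.leadingLCoeff, hr0, iteratedDeriv_zero, Nat.factorial_zero,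
      Nat.cast_one, div_one, W.regulator_eq_one_of_rank_zero hmw0] at hsha
    rw [hq₀def]
    push_cast
    rw [div_eq_iff hΩ]
    have : W.entireLFunction 1 = (q : ℂ) * ((W.realPeriodRat : ℂ) * (W.tamagawaProduct : ℂ)) /
        (W.torsionOrder : ℂ) ^ 2 := by
      rw [eq_div_iff (pow_ne_zero 2 ht0'), ← hsha]
      push_cast
      field_simp
    rw [this]
    field_simp
  have hq0 : q ≠ 0 := by
    rintro rfl
    have := rankZero_witness_ne_zero W hL hq₀
    simp [hq₀def] at this
  have hq₀0 : q₀ ≠ 0 := rankZero_witness_ne_zero W hL hq₀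
  refine ⟨q₀, hq₀, ?_⟩
  have hsha : padicValNat p (Nat.card (AddCommGroup.primaryComponent W.sha p)) =
      padicValNat p W.shaOrder := by
    unfold WeierstrassCurve.shaOrder
    exact padicValNat_card_addPrimaryComponent p
  have htors0 : padicValNat p W.torsionOrder = 0 :=
    padicValNat_torsionOrder_eq_zero_of_irreducible W p hirr
  have hv : padicValRat p q₀ = padicValRat p q + padicValNat p W.tamagawaProduct := by
    have h2 : padicValRat p ((W.torsionOrder : ℚ) ^ 2) = 2 * padicValRat p (W.torsionOrder : ℚ) := by
      rw [pow_two, padicValRat.mul ht0 ht0]; ring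
    rw [hq₀def, padicValRat.div (mul_ne_zero hq0 hc0) (pow_ne_zero 2 ht0), padicValRat.mul hq0 hc0,
      h2, padicValRat.of_nat, padicValRat.of_nat, htors0]
    push_cast; ring
  rw [hsha, hv]
  exact hle

/-- **`X4SharpThreeKim ⟺ X4SharpThree` on the `3`-adic tower rows** (granted GZK `hGZK` and
modularity `hmod`, which translate `L(E,1) ≠ 0 ∧ Ш finite` ↔ `analyticRank = 0`): the N11
hypothesis in Kim's binder shape is EXACTLY the cell's data-suggested conjecture `X4SharpThree`
(`SharpenedStatements.lean` l. 240) restricted to the rows with `ρ̄_{E,3^n}` onto for all `n` — the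
binder-by-binder comparison asked by REFEREE-1 R3, as a kernel theorem. The rows of `X4SharpThree`
OUTSIDE the tower are the EXOTIC residue (Elkies' `9`-deficient family), listed separately by the
cell (`x4SharpUnitFree_iff_lower_and_residues_sharp`). [cite: Kim2022StructureSelmer, Thm. 1.9 (6), §1.2.5]
[cite: Miller2011LMS, Def. 1.1] -/
theorem x4SharpThreeKim_iff_x4SharpThree_tower
    (hGZK : rank_eq_analyticRank_of_analyticRank_le_one) (hmod : hasEntireLFunction_rat) :
    X4SharpThreeKim ↔
      ∀ (W : WeierstrassCurve ℚ) [W.IsElliptic] [W.IsGloballyMinimal],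
        W.analyticRank = 0 → ClassX4 W 3 → Surj W 3 →
        (∀ n : ℕ, W.HasSurjectiveModNGaloisRep (3 ^ n : ℕ)) →
        ∀ {N : ℕ} [NeZero N] (D : ModularParametrizationData W N), ¬ (3 : ℤ) ∣ D.maninConstant →
        ∃ q : ℚ, shaAn W = (q : ℂ) ∧
          (padicValNat 3 W.shaOrder : ℤ) ≤ padicValRat 3 q + padicValNat 3 W.tamagawaProduct := by
  constructor
  · intro hK V _ _ hr hX hs ht N _ D hc
    exact padicValNat_shaOrder_le_of_kimRankZeroBoundAt V 3 hGZK (hK V hX.2.1)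
      ((V.analyticRank_eq_zero_iff_holds (hmod V)).mp hr) hs ht D hc
  · intro h V _ _ hA hs ht hL hfin N _ D hc
    have hr0 : V.analyticRank = 0 := analyticRank_eq_zero_of_entireLFunction_one_ne_zero hL
    obtain ⟨hmw, -⟩ := hGZK V (by rw [hr0]; exact zero_le_one)
    haveI : Finite V.sha := hfin
    have hirr : Irr V 3 := hasIrreducibleModPGaloisRep_of_hasSurjectiveModNGaloisRep V 3 hs
    exact kimConclusion_of_shaOrder_le V 3 hmw hL hirr
      (h V hr0 ⟨by decide, hA, hirr⟩ hs ht D hc)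

/-- **`X4SharpThree ⇒ X4SharpThreeKim`** (X4SharpThree has no tower binder, so it covers the tower
rows a fortiori). [cite: Miller2011LMS, Def. 1.1] -/
theorem x4SharpThreeKim_of_x4SharpThree
    (hGZK : rank_eq_analyticRank_of_analyticRank_le_one) (hmod : hasEntireLFunction_rat)
    (h3 : X4SharpThree) : X4SharpThreeKim :=
  (x4SharpThreeKim_iff_x4SharpThree_tower hGZK hmod).mpr
    fun V _ _ hr hX hs _ _ _ D hc => h3 V hr hX hs D hc

/-- **`X4SharpThreeKim` + the EXOTIC rows ⇒ `X4SharpThree`**: the N11 hypothesis in Kim's shape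
gives the cell's conjecture back once the surj(3)-but-not-tower rows (Elkies' three `j`-invariants;
per pair a `3`-descent / Sel₃ certificate, additive-p4 V24) are supplied as the hypothesis
`hexotic` (stated in X4SharpThree's own currency). [cite: Miller2011LMS, Def. 1.1] -/
theorem x4SharpThree_of_x4SharpThreeKim_of_exotic
    (hGZK : rank_eq_analyticRank_of_analyticRank_le_one) (hmod : hasEntireLFunction_rat)
    (hK : X4SharpThreeKim)
    (hexotic : ∀ (W : WeierstrassCurve ℚ) [W.IsElliptic] [W.IsGloballyMinimal],
      W.analyticRank = 0 → ClassX4 W 3 → Surj W 3 →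
      ¬ (∀ n : ℕ, W.HasSurjectiveModNGaloisRep (3 ^ n : ℕ)) →
      ∀ {N : ℕ} [NeZero N] (D : ModularParametrizationData W N), ¬ (3 : ℤ) ∣ D.maninConstant →
      ∃ q : ℚ, shaAn W = (q : ℂ) ∧
        (padicValNat 3 W.shaOrder : ℤ) ≤ padicValRat 3 q + padicValNat 3 W.tamagawaProduct) :
    X4SharpThree := by
  intro V _ _ hr hX hs N _ D hc
  by_cases ht : ∀ n : ℕ, V.HasSurjectiveModNGaloisRep (3 ^ n : ℕ)
  · exact (x4SharpThreeKim_iff_x4SharpThree_tower hGZK hmod).mp hK V hr hX hs ht D hc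
  · exact hexotic V hr hX hs ht D hc

/-! ## §3b The inequality shape on N11's tower rows is DISCHARGED MODULO the cell's named facts

The cell's two printed upper-half routes at an additive `3` — additive-p1's (M) route
(`x4SharpThree_conclusion_of_potMult`: Delbourgo Prop. 4 `hDel`, modular parametrisation data
`hmodD`, Wuthrich L. 20 `hL20`, the `ω`-component of Kato's divisibility over `ℚ(ζ_{3^∞})` `hKatoω`,
GZK, modularity) on `ord₃ j < 0`, and the SHARP Kato 2004 Thm. 14.5 (3) + Prop. 14.16 (2) reading
(`x4SharpThree_holds_of_potGood_of_towerSurj_sharp`, named fact A161 `hKatoS` — a READING-FACT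
admitted at statement level, formal D-closure owed, flag
`Kato-14.5(3)-14.16(2)-additive-potgood-reading-sharp` — NO Tamagawa hypothesis) on `ord₃ j ≥ 0` with
the tower — cover EVERY tower row. Hence the INEQUALITY shape `X4SharpThreeKim` is discharged MODULO
those seven named facts (the same seven as `x4SharpThree_iff_residue_sharp`) — conditional, not
closed. What N11 keeps OPEN in Kim's shape is the EQUALITY / unit shape `X4SharpThreeKimUnit`
(clauses (1)+(6): the LOWER half; ANNOUNCED by Kim–Pollack arXiv:2505.09121v1 Cor. 1.7, PRE, flag
`Kim2025-preprint`), the sibling file `X4SharpThreeKimUnitLever`, and the EXOTIC rows. -/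

/-- **`X4SharpThreeKim` HOLDS modulo the cell's named facts** (sharp Kato A161 `hKatoS` — the
inequality shape is discharged MODULO this reading-fact, flag
`Kato-14.5(3)-14.16(2)-additive-potgood-reading-sharp`, D-closure owed; Delbourgo Prop. 4 `hDel`;
`hmodD`; Wuthrich L. 20 `hL20`; the `ω`-component divisibility `hKatoω`; GZK `hGZK`; modularity
`hmod`): Kim's clause-(6) INEQUALITY at `p = 3` on every additive tower row is a consequence of the
published theorems already consumed by the cell — (M) rows by additive-p1's route, potentially good
rows by Kato 14.5 (3) sharp. CONDITIONAL on the seven named facts (no conjecture).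
[cite: Kato2004Asterisque, Thm. 14.5 (3) (p. 236), Prop. 14.16 (2) (p. 244), Thm. 17.4 (3) (p. 273)]
[cite: Delbourgo1998, Prop. 4 (p. 144)] [cite: Wuthrich2014, Lemma 20 (p. 399)]
[cite: Kim2022StructureSelmer, Thm. 1.9 (6), §3.2.3 display before Thm. 3.7 (PDF p. 16)] -/
theorem x4SharpThreeKim_of_facts
    (hKatoS : Kato2004.rankZero_padicValNat_sha_le_sub_localTamagawa_of_additive_potGood_of_imageContainsSL2)
    (hDel : Delbourgo1998.prop4_rankZero_pow_dvd_constantCoeff)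
    (hGZK : rank_eq_analyticRank_of_analyticRank_le_one) (hmod : hasEntireLFunction_rat)
    (hmodD : nonempty_modularParametrizationData)
    (hL20 : Wuthrich2014.lemma20_surjective_threeAdic_of_semistable)
    (hKatoω : Wuthrich2014.kato_minusEigenCharIdeal_dvd_cyclotomicThree_of_surjective) :
    X4SharpThreeKim :=
  (x4SharpThreeKim_iff_x4SharpThree_tower hGZK hmod).mpr fun V _ _ hr hX hsurj htower _ _ D hc => by
    by_cases hj : padicValRat 3 V.j < 0
    · exact x4SharpThree_conclusion_of_potMult V hDel hGZK hmod hmodD hL20 hKatoω hr hX hsurj hj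
    · exact x4SharpThree_holds_of_potGood_of_towerSurj_sharp V hKatoS hGZK hmod hr hX (not_lt.mp hj)
        htower D hc

/-- **Per pair, fact by fact: `KimRankZeroBoundAt W 3` on a potentially GOOD additive tower row from
the sharp Kato reading ALONE** (+ GZK for `rank = r_an`; no Delbourgo / Wuthrich input, no Tamagawa
or `#Ш_an` hypothesis). [cite: Kato2004Asterisque, Thm. 14.5 (3) (p. 236), Prop. 14.16 (2) (p. 244)]
[cite: Kim2022StructureSelmer, §3.2.3 display before Thm. 3.7 (PDF p. 16)] -/
theorem kimRankZeroBoundAt_three_of_katoSharp_of_potGood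
    (hKatoS : Kato2004.rankZero_padicValNat_sha_le_sub_localTamagawa_of_additive_potGood_of_imageContainsSL2)
    (hGZK : rank_eq_analyticRank_of_analyticRank_le_one) (hmod : hasEntireLFunction_rat)
    (hA : Addv W 3) (hj : 0 ≤ padicValRat 3 W.j) : KimRankZeroBoundAt W 3 := by
  intro hsurj htower hL hfin N _ D hc
  haveI : Fact (Nat.Prime 3) := ⟨Nat.prime_three⟩
  have hr0 : W.analyticRank = 0 := analyticRank_eq_zero_of_entireLFunction_one_ne_zero hL
  obtain ⟨hmw, -⟩ := hGZK W (by rw [hr0]; exact zero_le_one)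
  haveI : Finite W.sha := hfin
  have hirr : Irr W 3 := hasIrreducibleModPGaloisRep_of_hasSurjectiveModNGaloisRep W 3 hsurj
  exact kimConclusion_of_shaOrder_le W 3 hmw hL hirr
    (x4SharpThree_holds_of_potGood_of_towerSurj_sharp W hKatoS hGZK hmod hr0 ⟨by decide, hA, hirr⟩ hj
      htower D hc)

/-- **Per pair: `KimRankZeroBoundAt W 3` on a potentially MULTIPLICATIVE additive row from
additive-p1's (M) route** (Delbourgo Prop. 4, `hmodD`, Wuthrich L. 20, `ω`-component divisibility,
GZK, modularity; the tower binder is not even used). [cite: Delbourgo1998, Prop. 4 (p. 144)]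
[cite: Wuthrich2014, Lemma 20 (p. 399), Cor. 19 (p. 398)] [cite: Kato2004Asterisque, Thm. 17.4 (3) (p. 273)] -/
theorem kimRankZeroBoundAt_three_of_potMult
    (hDel : Delbourgo1998.prop4_rankZero_pow_dvd_constantCoeff)
    (hGZK : rank_eq_analyticRank_of_analyticRank_le_one) (hmod : hasEntireLFunction_rat)
    (hmodD : nonempty_modularParametrizationData)
    (hL20 : Wuthrich2014.lemma20_surjective_threeAdic_of_semistable)
    (hKatoω : Wuthrich2014.kato_minusEigenCharIdeal_dvd_cyclotomicThree_of_surjective)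
    (hA : Addv W 3) (hj : padicValRat 3 W.j < 0) : KimRankZeroBoundAt W 3 := by
  intro hsurj _ hL hfin N _ D _
  haveI : Fact (Nat.Prime 3) := ⟨Nat.prime_three⟩
  have hr0 : W.analyticRank = 0 := analyticRank_eq_zero_of_entireLFunction_one_ne_zero hL
  obtain ⟨hmw, -⟩ := hGZK W (by rw [hr0]; exact zero_le_one)
  haveI : Finite W.sha := hfin
  have hirr : Irr W 3 := hasIrreducibleModPGaloisRep_of_hasSurjectiveModNGaloisRep W 3 hsurj
  exact kimConclusion_of_shaOrder_le W 3 hmw hL hirr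
    (x4SharpThree_conclusion_of_potMult W hDel hGZK hmod hmodD hL20 hKatoω hr0 ⟨by decide, hA, hirr⟩
      hsurj hj)

end Summit.BirchSwinnertonDyer.Rank1Residual.Additive

end
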